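import Literature.NumberTheory.Rogawski1990.ArchTransfFamily                           -- ★ p849747 LH7-p02 (g2) (TRANSF-DEF): `transfFamReg`, `slotPerm`, `partnerPerms`, `partnerWeight`; brings ★ (COORD) `archRH`∕`archRG`∕`archERhoG`∕`RegS`∕`RegG`
import Literature.NumberTheory.Rogawski1990.ArchExplicitTransferFactorAtlasGeneral     -- ★ p849869 LH4-p03 (g4) (I₁-Δ-S) PART 2b: `archExplicitDelta_atlas_eq_mul` (`Δ″ = K^S_ρ · τ·D`); brings PART 1 `exists_archTau_mul_archWeylRatio_endoTorus_eq`
import Mathlib.LinearAlgebra.Vandermonde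
import HarnessLib

/-!
# (GLUE-X-dress) FILE A — the MIRROR PAIRING of the partner sum `transfFamReg`: `Δ″`'s zero eats the Weyl denominator's zero
# (Rogawski 1990 §4.3 (4.3.1) p. 43, §4.9 p. 55, §14.3 pp. 233–234; Shelstad 1979 §4 pp. 22–26; Bouaziz 1994 Rem. 2 p. 594)

Topic `NumberTheory/Rogawski1990`; namespace `Literature.NumberTheory.Rogawski1990`.  THEOREMS ONLY (no `def`, no instance, no notation, no axiom, no named fact, no `sorry`).
Cell `pub/hodgecm-mathlib`, crux H413 (`stmt-HodgeConjecture-24833`), F0∕P3c line LH3 (closer stub `stub_N9`, DIRECT ROAD «Transf», organ O-L2 `stub_N9transf`); brick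
**(GLUE-X-dress)** of LH3-plan (g2)'s ruling 2026-09-02T06:35:47Z («`transfFamReg` is `C^∞` across every `G`-singular `H`-regular hyperplane inside `InRegS S` at a place
`w ∉ S`, by PAIRING the partners `ρ, ρ∘swap` mirrored across the `G′`-noncompact wall»), FILE A = the ALGEBRA (no analysis); seat F0P3a-p09 (g5).  FILE B
(`ArchTransfFamilySmoothAcross`) glues the paired bracket with F0P3a-p02 (g19)'s ★ (GLUE-X-gen) `SmoothGluingAcrossHyperplane(Ray)`.

THE MATHEMATICS.  On the `H`-chart `S` (admissible: `S ⊆ splitChartPlaces L α`) the candidate transfer is, on the `G`-regular set (★ `transfFamReg`),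
`Ψ_S(c) = R_H(c) · w_S · Σ_{ρ ∈ partnerPerms S} Δ″(endoTorus S c, gprimeTorus S (ρ·c)) · F S (ρ·c) ∕ R′(ρ·c)` (`ρ·c = slotPerm ρ c`).  Three exact identities reorganise it:
* **(Δ) ★ `archExplicitDelta_atlas_eq_mul`**: `Δ″(endoTorus S c, gprimeTorus S (ρ·c)) = K_ρ · (τD)(c)` with `K_ρ = Π_w sgn(re σ_w α_{τ_w(ρ_w⁻¹ 1)})·η_w` a CONSTANT and
  `(τD)(c) = τ(endoTorus S c)·D_{G∕H}(endoTorus S c)` INDEPENDENT of `ρ`, a smooth LAURENT POLYNOMIAL in the `H`-eigenvalues `E_w = (e^{ic_w0}, e^{ic_w1}, e^{ic_w2})` (compact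
  `w`) ∕ `boostEig (c w)` (split `w`): ★ `exists_archTau_mul_archWeylRatio_endoTorus_eq`, `(τD) = Π_w −((E₀E₂)^{k_w}(E₁−E₀)(E₁−E₂))∕E₁`.
* **(W) the Weyl denominator**: `F S ∕ R′ = 'F ∕ Δ_G` with `'F := archERhoG S · F S` (the `ρ`-twisted family that (I₃) differentiates) and `Δ_G := archERhoG S · archRG S`; at a compact place
  `Δ_G = e^{i(θ₀−θ₂)}·Π_{i<j}(1 − e^{i(θ_j−θ_i)}) = (E₀−E₁)(E₀−E₂)(E₁−E₂)∕(E₀E₁E₂)` in the slot eigenvalues (§1 `archERhoG_mul_archRG_compactFactor`) — ALTERNATING under slot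
  permutations (Vandermonde, §1 `vand3_perm`): **`Δ_G(ρ·c) = σ(ρ)·Δ_G(c)`**, `σ(ρ) = Π_w sign(ρ_w)` (§3 `archERhoG_mul_archRG_slotPerm`).
* **(C) THE CANCELLATION**: at a compact place `−((E₀E₂)^k(E₁−E₀)(E₁−E₂))∕E₁ = [(E₀E₂)^k·E₀E₂∕(E₀−E₂)] · (E₀−E₁)(E₀−E₂)(E₁−E₂)∕(E₀E₁E₂)` whenever `E₀ ≠ E₂` (the two `G`-root factors
  of `τD` ARE two of the three root factors of `Δ_G`): **`(τD)(c) = M♭(c)·Δ_G(c)` on `RegS S`** with `M♭` an explicit product of per-place factors that are smooth on the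
  `H`-regular set (compact places `(E₀E₂)^k E₀E₂∕(E₀−E₂)`, split places `(τD)_w ∕ R′_w`) — §3 `archTauWeyl_eq_prefactor_mul` (FILE A2 proves `ContDiffOn ℝ ∞ M♭ (RegS S)`).
Hence **§4 `transfFamReg_eq_prefactor_mul_sum`**: on `RegG S`, `Ψ_S(c) = M(c) · Σ_ρ (K_ρ·σ(ρ)) · 'F(ρ·c)` with `M = R_H · w_S · M♭` — EVERY division is gone, the zero of `Δ_G` on
the `G`-walls has been eaten by the zero of `Δ″`.  And **§2∕§4 the MIRROR REGROUPING** (no representatives): for `w ∉ S` and any `π ∈ S₃`, `ρ ↦ update ρ w (π·ρ_w)` permutes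
★ `partnerPerms S` (`sum_partnerPerms_comp_update`), `slotPerm (update ρ w (swap x y·ρ_w)) c = swap of the slots ρ_w⁻¹x, ρ_w⁻¹y at w of slotPerm ρ c` (`slotPerm_update_swap_mul`), and
`sign` flips; so `Σ_ρ (K_ρσ(ρ)) 'F(ρ·c) = ½ Σ_ρ (K_ρσ(ρ)) · ('F(ρ·c) − ε_ρ · 'F(s_ρ(ρ·c)))` with `ε_ρ = K_{ρ°}∕K_ρ = sgn(slot ρ_w⁻¹x)·sgn(slot ρ_w⁻¹y) ∈ {±1}`
(`transfFamReg_eq_prefactor_mul_sum_pairs`): across a NONCOMPACT slot pair (`ε = −1`) the bracket is `'F + 'F∘s`, whose odd normal jets are killed by (I₃) + (W).2 (FILE B);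
across a COMPACT pair (`ε = +1`) it is `'F − 'F∘s`, smooth outright by (I₁).  HONEST LABEL: HC_CM is proved only modulo the 7 printed citations (2 remaining named inputs:
hLiu418 = `stmt-HodgeConjecture-24832`, h413 = `stmt-HodgeConjecture-24833`) until rung 0 closes; this file is count-neutral algebra under O-L2 and pays no organ.

## References
* [Rogawski1990] J. D. Rogawski, *Automorphic Representations of Unitary Groups in Three Variables*, Ann. of Math. Stud. 123 (1990), §4.3 (4.3.1) p. 43, §4.9 p. 55, §8.2
  pp. 118–123, §14.3 pp. 233–234, §14.6 p. 242.
* [Shelstad1979] D. Shelstad, *Characters and inner forms of a quasi-split group over ℝ*, Compositio Math. 39 (1979), §4 pp. 22–26 (`R_T`, Lemma 4.2, Prop. 4.5).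
* [Bouaziz1994IntegralesOrbitales] A. Bouaziz, *Intégrales orbitales sur les groupes de Lie réductifs*, Ann. Sci. ÉNS 27 (1994), Rem. 2 p. 594 («Transf»), §3.2 p. 580.
* [LanglandsShelstad1987] R. P. Langlands, D. Shelstad, *On the definition of transfer factors*, Math. Ann. 278 (1987), §2.4.
-/

set_option autoImplicit false

noncomputable section

open NumberField NumberField.InfinitePlace Complex Equiv Finset
open scoped MatrixGroups ComplexConjugate Classical
open Literature.NumberTheory.Automorphic Literature.NumberTheory.Automorphic.UnitaryGroup Literature.NumberTheory.Automorphic.ArchCartan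
open Literature.NumberTheory.GaloisRepresentations

namespace Literature.NumberTheory.Rogawski1990

/-! ## §1 Per-place algebra: the Weyl denominator at a compact place, its alternation, the cancellation against `τ·D` -/

section PlaceAlgebra

/-- **The Weyl denominator at a compact place**: `e^{i(θ₀−θ₂)} · Π_{i<j}(1 − e^{i(θ_j−θ_i)}) = (E₀−E₁)(E₀−E₂)(E₁−E₂)∕(E₀E₁E₂)`, `E_i = e^{iθ_i}` — the product of
★ `archERhoG`'s and ★ `archRG`'s compact factors is a rational (Vandermonde) function of the slot eigenvalues. [cite: Shelstad1979, §4 p. 22; §4 p. 24]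
[cite: Bouaziz1994IntegralesOrbitales, §6.2 p. 591] -/
theorem archERhoG_mul_archRG_compactFactor (θ : Fin 3 → ℝ) :
    (Circle.exp (θ 0 - θ 2) : ℂ) * ((1 - (Circle.exp (θ 1 - θ 0) : ℂ)) * (1 - (Circle.exp (θ 2 - θ 0) : ℂ)) * (1 - (Circle.exp (θ 2 - θ 1) : ℂ))) =
      ((Circle.exp (θ 0) : ℂ) - Circle.exp (θ 1)) * ((Circle.exp (θ 0) : ℂ) - Circle.exp (θ 2)) * ((Circle.exp (θ 1) : ℂ) - Circle.exp (θ 2)) /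
        ((Circle.exp (θ 0) : ℂ) * Circle.exp (θ 1) * Circle.exp (θ 2)) := by
  have h0 : (Circle.exp (θ 0) : ℂ) ≠ 0 := Circle.coe_ne_zero _
  have h1 : (Circle.exp (θ 1) : ℂ) ≠ 0 := Circle.coe_ne_zero _
  have h2 : (Circle.exp (θ 2) : ℂ) ≠ 0 := Circle.coe_ne_zero _
  simp only [Circle.exp_sub, Circle.coe_div]
  field_simp

/-- **The Vandermonde product of three numbers is ALTERNATING**: `V(E∘π) = sign(π)·V(E)`, `V(E) = (E₀−E₁)(E₀−E₂)(E₁−E₂)` (Mathlib `det_vandermonde`, `det_permute`).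
[cite: Shelstad1979, Lemma 4.2 (p. 23)] -/
theorem vand3_perm (E : Fin 3 → ℂ) (π : Perm (Fin 3)) :
    (E (π 0) - E (π 1)) * (E (π 0) - E (π 2)) * (E (π 1) - E (π 2)) = (Equiv.Perm.sign π : ℂ) * ((E 0 - E 1) * (E 0 - E 2) * (E 1 - E 2)) := by
  have hdet : ∀ v : Fin 3 → ℂ, (Matrix.vandermonde v).det = -((v 0 - v 1) * (v 0 - v 2) * (v 1 - v 2)) := by
    intro v
    rw [Matrix.det_fin_three]
    simp only [Matrix.vandermonde_apply, Fin.val_zero, pow_zero, Fin.val_one, pow_one, Fin.val_two]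
    ring
  have hsub : Matrix.vandermonde (E ∘ π) = (Matrix.vandermonde E).submatrix π id := by
    ext i j
    simp only [Matrix.vandermonde_apply, Function.comp_apply, Matrix.submatrix_apply, id_eq]
  have h := Matrix.det_permute π (Matrix.vandermonde E)
  rw [← hsub, hdet, hdet] at h
  simp only [Function.comp_apply] at h
  have h' : (E (π 0) - E (π 1)) * (E (π 0) - E (π 2)) * (E (π 1) - E (π 2)) = -((Equiv.Perm.sign π : ℂ) * -((E 0 - E 1) * (E 0 - E 2) * (E 1 - E 2))) := by
    rw [← h, neg_neg]
  rw [h']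
  ring

/-- **THE CANCELLATION at a compact place**: `−((E₀E₂)^k(E₁−E₀)(E₁−E₂))∕E₁ = [(E₀E₂)^k·E₀·E₂∕(E₀−E₂)] · [(E₀−E₁)(E₀−E₂)(E₁−E₂)∕(E₀E₁E₂)]` for `E₀ ≠ E₂` (`E_i ≠ 0`): the two
`G∕H`-root factors of `τ·D` are two of the three root factors of the Weyl denominator, leaving `1∕(E₀−E₂)` — smooth on the `H`-REGULAR set, across the `G`-walls
`E₁ = E₀`, `E₁ = E₂`. [cite: Rogawski1990, §4.9 p. 55; §8.2 p. 118] [cite: Shelstad1979, §4 p. 22] -/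
theorem tauD_compactFactor_eq_prefactor_mul {E : Fin 3 → ℂ} (h0 : E 0 ≠ 0) (h1 : E 1 ≠ 0) (h2 : E 2 ≠ 0) (h02 : E 0 ≠ E 2) (u : ℂ) :
    -(u * ((E 1 - E 0) * (E 1 - E 2)) / E 1) =
      (u * (E 0 * E 2) / (E 0 - E 2)) * ((E 0 - E 1) * (E 0 - E 2) * (E 1 - E 2) / (E 0 * E 1 * E 2)) := by
  have h02' : E 0 - E 2 ≠ 0 := sub_ne_zero.2 h02
  field_simp
  ring

end PlaceAlgebra

/-! ## §2 The partner set `partnerPerms S`: relabelling at a compact place, the slot swap -/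

section Partners

variable {W : Type*} [Fintype W] [DecidableEq W]

/-- Relabelling the slots at a COMPACT place `w ∉ S` (left multiplication of `ρ_w` by a fixed `π`) preserves ★ `partnerPerms S` (identity at the split places, free at the
compact ones). [cite: Shelstad1979, Lemma 4.2 (p. 23)] -/
theorem update_mul_mem_partnerPerms_iff {S : Finset W} {w : W} (hw : w ∉ S) (π : Perm (Fin 3)) (ρ : W → Perm (Fin 3)) :
    Function.update ρ w (π * ρ w) ∈ partnerPerms S ↔ ρ ∈ partnerPerms S := by
  rw [mem_partnerPerms_iff, mem_partnerPerms_iff]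
  refine forall_congr' fun w' => forall_congr' fun hw' => ?_
  have hne : w' ≠ w := fun h => hw (h ▸ hw')
  rw [Function.update_of_ne hne]

/-- **The relabelling `ρ ↦ update ρ w (π·ρ_w)` PERMUTES the partner sum** (it is a bijection of `partnerPerms S` with inverse `π⁻¹`): `Σ_ρ f(update ρ w (π·ρ_w)) = Σ_ρ f ρ`.
[cite: Shelstad1979, Lemma 4.2 (p. 23)] [cite: Rogawski1990, §4.3 (4.3.1) p. 43] -/
theorem sum_partnerPerms_comp_update {M : Type*} [AddCommMonoid M] {S : Finset W} {w : W} (hw : w ∉ S) (π : Perm (Fin 3))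
    (f : (W → Perm (Fin 3)) → M) :
    ∑ ρ ∈ partnerPerms S, f (Function.update ρ w (π * ρ w)) = ∑ ρ ∈ partnerPerms S, f ρ := by
  refine Finset.sum_bij' (fun ρ _ => Function.update ρ w (π * ρ w)) (fun ρ _ => Function.update ρ w (π⁻¹ * ρ w)) ?_ ?_ ?_ ?_ ?_
  · exact fun ρ hρ => (update_mul_mem_partnerPerms_iff hw π ρ).2 hρ
  · exact fun ρ hρ => (update_mul_mem_partnerPerms_iff hw π⁻¹ ρ).2 hρ
  · intro ρ _
    rw [Function.update_idem, Function.update_self, ← mul_assoc, inv_mul_cancel, one_mul, Function.update_eq_self]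
  · intro ρ _
    rw [Function.update_idem, Function.update_self, ← mul_assoc, mul_inv_cancel, one_mul, Function.update_eq_self]
  · intro ρ _
    rfl

/-- **Mirror regrouping**: `Σ_ρ f ρ = ½ Σ_ρ (f ρ + f(update ρ w (π·ρ_w)))` over `partnerPerms S` (`w ∉ S`) — no choice of representatives. [cite: Rogawski1990, §4.3 (4.3.1) p. 43] -/
theorem sum_partnerPerms_eq_half_sum_add_update {S : Finset W} {w : W} (hw : w ∉ S) (π : Perm (Fin 3)) (f : (W → Perm (Fin 3)) → ℂ) :
    ∑ ρ ∈ partnerPerms S, f ρ = (1 / 2 : ℂ) * ∑ ρ ∈ partnerPerms S, (f ρ + f (Function.update ρ w (π * ρ w))) := by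
  rw [Finset.sum_add_distrib, sum_partnerPerms_comp_update hw π f]
  ring

omit [Fintype W] in
/-- **The relabelled partner point is the SLOT SWAP of the old one**: `slotPerm (update ρ w (swap x y · ρ_w)) c` equals `slotPerm ρ c` with the slots `ρ_w⁻¹ x`, `ρ_w⁻¹ y` at `w`
exchanged (= ★ `hcSwapAt w (ρ_w⁻¹ x) (ρ_w⁻¹ y) (slotPerm ρ c)` by `rfl`; spelled with `Function.update` to keep this file free of the D2′ import). [cite: Shelstad1979, §4 p. 23] -/
theorem slotPerm_update_swap_mul (ρ : W → Perm (Fin 3)) (w : W) (x y : Fin 3) (c : W → Fin 3 → ℝ) :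
    slotPerm (Function.update ρ w (Equiv.swap x y * ρ w)) c =
      Function.update (slotPerm ρ c) w ((slotPerm ρ c) w ∘ ⇑(Equiv.swap ((ρ w).symm x) ((ρ w).symm y))) := by
  funext w' i
  by_cases h : w' = w
  · subst h
    rw [slotPerm_apply, Function.update_self, Function.update_self, Function.comp_apply, slotPerm_apply, Equiv.Perm.mul_apply]
    congr 1
    have e := congrArg (fun σ : Perm (Fin 3) => σ (ρ w' i)) (Equiv.swap_apply_apply (ρ w') ((ρ w').symm x) ((ρ w').symm y))
    simp only [Equiv.apply_symm_apply, Equiv.Perm.mul_apply] at e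
    rw [Equiv.Perm.inv_def, Equiv.symm_apply_apply] at e
    exact e
  · rw [slotPerm_apply, Function.update_of_ne h, Function.update_of_ne h, slotPerm_apply]

omit [Fintype W] in
/-- The relabelled partner point at the other places and slots: unchanged off `w`. [cite: Shelstad1979, §4 p. 23] -/
theorem slotPerm_update_apply_of_ne (ρ : W → Perm (Fin 3)) {w w' : W} (h : w' ≠ w) (π : Perm (Fin 3)) (c : W → Fin 3 → ℝ) :
    slotPerm (Function.update ρ w π) c w' = slotPerm ρ c w' := by
  funext i
  rw [slotPerm_apply, Function.update_of_ne h, slotPerm_apply]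

end Partners


/-! ## §3 Chart identities: the Weyl denominator alternates under relabelling; `τ·D = M♭ · Δ_G` on the `H`-regular set -/

section Chart

variable {W : Type*} [Fintype W] [DecidableEq W]

/-- **`Δ_G(ρ·c) = σ(ρ)·Δ_G(c)`** — the Weyl denominator `archERhoG S · archRG S` of the `G′`-chart `S` is ALTERNATING under the partner relabellings: for `ρ ∈ partnerPerms S`
(`ρ_w = 1` at `w ∈ S`), `archERhoG S (ρ·c)·archRG S (ρ·c) = (Π_w sign ρ_w)·archERhoG S c·archRG S c` (§1 per compact place; split places untouched).
[cite: Shelstad1979, §4 p. 22; Lemma 4.2 (p. 23)] [cite: Bouaziz1994IntegralesOrbitales, §6.2 p. 591] -/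
theorem archERhoG_mul_archRG_slotPerm {S : Finset W} {ρ : W → Perm (Fin 3)} (hρ : ρ ∈ partnerPerms S) (c : W → Fin 3 → ℝ) :
    archERhoG S (slotPerm ρ c) * archRG S (slotPerm ρ c) = (∏ w, (Equiv.Perm.sign (ρ w) : ℂ)) * (archERhoG S c * archRG S c) := by
  unfold archERhoG archRG
  rw [← Finset.prod_mul_distrib, ← Finset.prod_mul_distrib, ← Finset.prod_mul_distrib]
  refine Finset.prod_congr rfl fun w _ => ?_
  by_cases hw : w ∈ S
  · -- split place: `ρ_w = 1`, nothing moves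
    rw [if_pos hw, if_pos hw, if_pos hw, if_pos hw, eq_one_of_mem_partnerPerms hρ hw, Equiv.Perm.sign_one, Units.val_one, Int.cast_one, one_mul,
      slotPerm_apply_of_mem hρ hw, one_mul, one_mul]
  · -- compact place: Vandermonde alternation
    rw [if_neg hw, if_neg hw, if_neg hw, if_neg hw]
    simp only [slotPerm_apply]
    rw [archERhoG_mul_archRG_compactFactor (fun i => c w (ρ w i)), archERhoG_mul_archRG_compactFactor (c w)]
    have hV : ((Circle.exp (c w (ρ w 0)) : ℂ) - Circle.exp (c w (ρ w 1))) * ((Circle.exp (c w (ρ w 0)) : ℂ) - Circle.exp (c w (ρ w 2))) *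
        ((Circle.exp (c w (ρ w 1)) : ℂ) - Circle.exp (c w (ρ w 2))) =
        (Equiv.Perm.sign (ρ w) : ℂ) * (((Circle.exp (c w 0) : ℂ) - Circle.exp (c w 1)) * ((Circle.exp (c w 0) : ℂ) - Circle.exp (c w 2)) *
          ((Circle.exp (c w 1) : ℂ) - Circle.exp (c w 2))) :=
      vand3_perm (fun i => (Circle.exp (c w i) : ℂ)) (ρ w)
    rw [hV]
    have hden : (Circle.exp (c w (ρ w 0)) : ℂ) * Circle.exp (c w (ρ w 1)) * Circle.exp (c w (ρ w 2)) =
        (Circle.exp (c w 0) : ℂ) * Circle.exp (c w 1) * Circle.exp (c w 2) := by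
      have h := Equiv.prod_comp (ρ w) (fun i => (Circle.exp (c w i) : ℂ))
      simp only [Fin.prod_univ_three] at h
      exact h
    rw [hden]
    ring

omit [DecidableEq W] in
/-- The square of the relabelling sign is `1`. [cite: Shelstad1979, Lemma 4.2 (p. 23)] -/
theorem prod_sign_mul_self (ρ : W → Perm (Fin 3)) :
    (∏ w, (Equiv.Perm.sign (ρ w) : ℂ)) * (∏ w, (Equiv.Perm.sign (ρ w) : ℂ)) = 1 := by
  rw [← Finset.prod_mul_distrib]
  refine Finset.prod_eq_one fun w _ => ?_
  rcases Int.units_eq_one_or (Equiv.Perm.sign (ρ w)) with h | h <;> simp [h]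

/-- Relabelling at a compact place by a transposition flips the sign: `Π_w sign((update ρ w (swap x y·ρ_w)) w′) = −Π_w sign(ρ_w′)` (`x ≠ y`).
[cite: Shelstad1979, Lemma 4.2 (p. 23)] -/
theorem prod_sign_update_swap_mul (ρ : W → Perm (Fin 3)) (w : W) {x y : Fin 3} (hxy : x ≠ y) :
    (∏ w', (Equiv.Perm.sign ((Function.update ρ w (Equiv.swap x y * ρ w)) w') : ℂ)) = -∏ w', (Equiv.Perm.sign (ρ w') : ℂ) := by
  rw [← Finset.mul_prod_erase Finset.univ _ (Finset.mem_univ w), ← Finset.mul_prod_erase Finset.univ (fun w' => (Equiv.Perm.sign (ρ w') : ℂ)) (Finset.mem_univ w),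
    Function.update_self, Equiv.Perm.sign_mul, Equiv.Perm.sign_swap hxy, Units.val_mul, Units.val_neg, Units.val_one, Int.cast_mul, Int.cast_neg, Int.cast_one]
  rw [Finset.prod_congr rfl fun w' hw' => by rw [Function.update_of_ne (Finset.ne_of_mem_erase hw')]]
  ring

/-- **THE CANCELLATION ON THE CHART: `τ·D = M♭ · Δ_G` on the `H`-regular set `RegS S`** (all divisions legitimate there).  Here `τ·D` is ★ PART 1's Laurent form with exponents
`k` (`Π_w −((E₀E₂)^{k_w}(E₁−E₀)(E₁−E₂))∕E₁`, `E_w = boostEig (c w)` at `w ∈ S`, `(e^{ic_w·})` at `w ∉ S`), `Δ_G = archERhoG S c · archRG S c`, and the PREFACTOR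
`M♭(c) = Π_w m♭_w(c)`: at a compact place `(E₀E₂)^{k_w}·E₀E₂∕(E₀ − E₂)` (smooth on `e^{ic_w0} ≠ e^{ic_w2}`), at a split place the plain quotient `(τD)_w ∕ R′_w` (smooth on `x_w ≠ 0`).
[cite: Rogawski1990, §4.9 p. 55; §8.2 p. 118] [cite: Shelstad1979, §4 p. 22] -/
theorem tauD_eq_prefactor_mul_weylDenominator (S : Finset W) (k : W → ℤ) {c : W → Fin 3 → ℝ} (hc : c ∈ RegS S) :
    (∏ w : W,
        -(((((if w ∈ S then boostEig (c w) else fun i => (Circle.exp (c w i) : ℂ)) 0) * ((if w ∈ S then boostEig (c w) else fun i => (Circle.exp (c w i) : ℂ)) 2)) ^ (k w)) *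
            ((((if w ∈ S then boostEig (c w) else fun i => (Circle.exp (c w i) : ℂ)) 1) - ((if w ∈ S then boostEig (c w) else fun i => (Circle.exp (c w i) : ℂ)) 0)) *
              (((if w ∈ S then boostEig (c w) else fun i => (Circle.exp (c w i) : ℂ)) 1) - ((if w ∈ S then boostEig (c w) else fun i => (Circle.exp (c w i) : ℂ)) 2))) /
          ((if w ∈ S then boostEig (c w) else fun i => (Circle.exp (c w i) : ℂ)) 1))) =
      (∏ w : W, if w ∈ S then
          -((((boostEig (c w) 0) * (boostEig (c w) 2)) ^ (k w)) * (((boostEig (c w) 1) - (boostEig (c w) 0)) * ((boostEig (c w) 1) - (boostEig (c w) 2))) /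
              (boostEig (c w) 1)) /
            ((|Real.exp (c w 0) - Real.exp (-c w 0)| *
                ‖Complex.exp (c w 0 + c w 2 * I) - Complex.exp (c w 1 * I)‖ * ‖Complex.exp (-c w 0 + c w 2 * I) - Complex.exp (c w 1 * I)‖ : ℝ) : ℂ)
        else (((Circle.exp (c w 0) : ℂ) * Circle.exp (c w 2)) ^ (k w)) * ((Circle.exp (c w 0) : ℂ) * Circle.exp (c w 2)) /
          ((Circle.exp (c w 0) : ℂ) - Circle.exp (c w 2))) *
        (archERhoG S c * archRG S c) := by
  unfold archERhoG archRG
  rw [← Finset.prod_mul_distrib, ← Finset.prod_mul_distrib]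
  refine Finset.prod_congr rfl fun w _ => ?_
  by_cases hw : w ∈ S
  · -- split place: `(τD)_w = ((τD)_w ∕ R′_w) · (1 · R′_w)`
    simp only [if_pos hw, one_mul]
    have hx : c w 0 ≠ 0 := ((mem_regS_iff S c).1 hc).2 w hw
    have hR : (((|Real.exp (c w 0) - Real.exp (-c w 0)| *
        ‖Complex.exp (c w 0 + c w 2 * I) - Complex.exp (c w 1 * I)‖ * ‖Complex.exp (-c w 0 + c w 2 * I) - Complex.exp (c w 1 * I)‖ : ℝ) : ℂ)) ≠ 0 := by
      rw [Complex.ofReal_ne_zero]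
      refine mul_ne_zero (mul_ne_zero ((abs_exp_sub_exp_neg_ne_zero_iff _).2 hx) (norm_exp_add_mul_I_sub_exp_mul_I_ne_zero hx _ _)) ?_
      simpa only [Complex.ofReal_neg] using norm_exp_add_mul_I_sub_exp_mul_I_ne_zero (neg_ne_zero.2 hx) (c w 2) (c w 1)
    rw [div_mul_cancel₀ _ hR]
  · -- compact place: §1 cancellation
    simp only [if_neg hw]
    rw [archERhoG_mul_archRG_compactFactor (c w)]
    have h02 : (Circle.exp (c w 0) : ℂ) ≠ Circle.exp (c w 2) := fun h => ((mem_regS_iff S c).1 hc).1 w hw (Subtype.ext h)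
    exact tauD_compactFactor_eq_prefactor_mul (E := fun i => (Circle.exp (c w i) : ℂ)) (Circle.coe_ne_zero _) (Circle.coe_ne_zero _) (Circle.coe_ne_zero _) h02 _

end Chart


/-! ## §4 The partner sum without divisions: `Ψ_S = M · Σ_ρ (K_ρ σ(ρ)) · 'F(ρ·c)` on `RegG S`, and its mirror-paired form -/

section Transf

variable (L : Type) [Field L] [NumberField L] [IsCMField L] (α : Fin 3 → L) (μ : HeckeCharacter L)

/-- `archERhoG S c ≠ 0` (a unit). [cite: Shelstad1979, §4 p. 24] -/
theorem archERhoG_ne_zero' {W : Type*} [Fintype W] [DecidableEq W] (S : Finset W) (c : W → Fin 3 → ℝ) : archERhoG S c ≠ 0 := by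
  intro h
  have h1 := norm_archERhoG S c
  rw [h, norm_zero] at h1
  exact zero_ne_one h1

/-- The scalar bookkeeping of one partner term: `Δ″ = K·τD`, `τD = M·Δ_G`, `'F∕Δ_G(ρ·c)` with `Δ_G(ρ·c) = σ·Δ_G(c)`, `σ² = 1` ⇒ `K·τD·(F∕R′) = M·(K·σ)·'F`.
[cite: Rogawski1990, §4.3 (4.3.1) p. 43] -/
theorem partnerTerm_algebra {K TD M Δ σ e f R : ℂ} (hTD : TD = M * Δ) (hR : e * R = σ * Δ) (hR0 : R ≠ 0) (hσ : σ * σ = 1) :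
    K * TD * (f / R) = M * ((K * σ) * (e * f)) := by
  have h1 : K * TD * (f / R) * R = K * TD * f := by rw [mul_assoc, div_mul_cancel₀ f hR0]
  have h2 : M * ((K * σ) * (e * f)) * R = K * TD * f := by
    calc M * ((K * σ) * (e * f)) * R = M * K * σ * f * (e * R) := by ring
      _ = M * K * σ * f * (σ * Δ) := by rw [hR]
      _ = M * K * f * Δ * (σ * σ) := by ring
      _ = K * (M * Δ) * f := by rw [hσ]; ring
      _ = K * TD * f := by rw [hTD]
  exact mul_right_cancel₀ hR0 (h1.trans h2.symm)

/-- **`Ψ_S = M · Σ_ρ (K_ρ·σ(ρ)) · 'F(ρ·c)` ON THE `G`-REGULAR SET — the partner sum of ★ `transfFamReg` WITHOUT DIVISIONS.**  For an admissible chart `S ⊆ splitChartPlaces L α`, exponents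
`k` satisfying ★ PART 1's Laurent identity `hk` (★ `exists_archTau_mul_archWeylRatio_endoTorus_eq` under the `μ`-guard), and `c ∈ RegG S`:
`transfFamReg L α μ F S c = (archRH S c · partnerWeight · M♭(c)) · Σ_{ρ ∈ partnerPerms S} (K_ρ · Π_w sign ρ_w) · (archERhoG S (ρ·c) · F S (ρ·c))`, `K_ρ` the constant of
★ `archExplicitDelta_atlas_eq_mul`, `M♭` the prefactor of `tauD_eq_prefactor_mul_weylDenominator` (smooth on `RegS S`, FILE A2).  ((Δ) + (W) + (C) of the header.)
[cite: Rogawski1990, §4.3 (4.3.1) p. 43; §4.9 p. 55; §14.3 pp. 233–234] [cite: Shelstad1979, §4 pp. 22–24] [cite: Bouaziz1994IntegralesOrbitales, Rem. 2 p. 594] -/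
theorem transfFamReg_eq_prefactor_mul_sum {S : Finset {w : InfinitePlace L // IsComplex w}} (hS : ∀ w ∈ S, w ∈ splitChartPlaces L α)
    (F : Finset {w : InfinitePlace L // IsComplex w} → ({w : InfinitePlace L // IsComplex w} → Fin 3 → ℝ) → ℂ) (k : {w : InfinitePlace L // IsComplex w} → ℤ)
    (hk : ∀ c : {w : InfinitePlace L // IsComplex w} → Fin 3 → ℝ,
      archTau L (endoTorus L S c) μ * (archWeylRatio L (endoTorus L S c) : ℂ) =
        ∏ w : {w : InfinitePlace L // IsComplex w},
          -(((((if w ∈ S then boostEig (c w) else fun i => (Circle.exp (c w i) : ℂ)) 0) * ((if w ∈ S then boostEig (c w) else fun i => (Circle.exp (c w i) : ℂ)) 2)) ^ (k w)) *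
              ((((if w ∈ S then boostEig (c w) else fun i => (Circle.exp (c w i) : ℂ)) 1) - ((if w ∈ S then boostEig (c w) else fun i => (Circle.exp (c w i) : ℂ)) 0)) *
                (((if w ∈ S then boostEig (c w) else fun i => (Circle.exp (c w i) : ℂ)) 1) - ((if w ∈ S then boostEig (c w) else fun i => (Circle.exp (c w i) : ℂ)) 2))) /
            ((if w ∈ S then boostEig (c w) else fun i => (Circle.exp (c w i) : ℂ)) 1)))
    {c : {w : InfinitePlace L // IsComplex w} → Fin 3 → ℝ} (hc : c ∈ RegG S) :
    transfFamReg L α μ F S c =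
      (archRH S c * partnerWeight L α S *
        ∏ w : {w : InfinitePlace L // IsComplex w}, (if w ∈ S then
          -((((boostEig (c w) 0) * (boostEig (c w) 2)) ^ (k w)) * (((boostEig (c w) 1) - (boostEig (c w) 0)) * ((boostEig (c w) 1) - (boostEig (c w) 2))) /
              (boostEig (c w) 1)) /
            ((|Real.exp (c w 0) - Real.exp (-c w 0)| *
                ‖Complex.exp (c w 0 + c w 2 * I) - Complex.exp (c w 1 * I)‖ * ‖Complex.exp (-c w 0 + c w 2 * I) - Complex.exp (c w 1 * I)‖ : ℝ) : ℂ)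
        else (((Circle.exp (c w 0) : ℂ) * Circle.exp (c w 2)) ^ (k w)) * ((Circle.exp (c w 0) : ℂ) * Circle.exp (c w 2)) /
          ((Circle.exp (c w 0) : ℂ) - Circle.exp (c w 2)))) *
      ∑ ρ ∈ partnerPerms S,
        (((∏ w : {w : InfinitePlace L // IsComplex w},
            ((SignType.sign ((w.1.embedding (α (lineOf (formSign L α w) ((ρ w).symm 1)))).re) : ℤ) * archMajoritySign L (Matrix.diagonal α) w) : ℤ) : ℂ) *
          ∏ w : {w : InfinitePlace L // IsComplex w}, (Equiv.Perm.sign (ρ w) : ℂ)) *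
        (archERhoG S (slotPerm ρ c) * F S (slotPerm ρ c)) := by
  have hcS : c ∈ RegS S := regG_subset_regS S hc
  have hTD := (hk c).trans (tauD_eq_prefactor_mul_weylDenominator S k hcS)
  unfold transfFamReg
  rw [mul_assoc (archRH S c * partnerWeight L α S) _ (∑ ρ ∈ partnerPerms S, _)]
  congr 1
  rw [Finset.mul_sum]
  refine Finset.sum_congr rfl fun ρ hρ => ?_
  have hρ1 : ∀ w ∈ S, ρ w = 1 := (mem_partnerPerms_iff S ρ).1 hρ
  -- (Δ): `Δ″ = K_ρ · τD`
  rw [show gprimeTorus L α S (slotPerm ρ c) = gprimeTorus L α S (fun v => c v ∘ ⇑(ρ v)) from rfl, archExplicitDelta_atlas_eq_mul L α μ c hS ρ hρ1]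
  -- (W) + (C), assembled by `partnerTerm_algebra`
  exact partnerTerm_algebra hTD (archERhoG_mul_archRG_slotPerm hρ c) (archRG_ne_zero_of_mem_regG ((slotPerm_mem_regG_iff hρ c).2 hc))
    (prod_sign_mul_self ρ)

end Transf


/-! ## §5 The mirror-paired form of the twisted partner sum -/

section Pairing

variable (L : Type) [Field L] [NumberField L] [IsCMField L] (α : Fin 3 → L)

/-- `sgn(x)² = 1` for `x ≠ 0` (in `ℤ`). [folklore] -/
private theorem sign_intCast_mul_self' {x : ℝ} (hx : x ≠ 0) : (SignType.sign x : ℤ) * (SignType.sign x : ℤ) = 1 := by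
  rcases hx.lt_or_gt with h | h
  · rw [sign_neg h]; norm_num
  · rw [sign_pos h]; norm_num

omit [NumberField L] [IsCMField L] in
/-- For a real non-zero `α_i` the real part of `σ_w(α_i)` is non-zero. [cite: Rogawski1990, §3.6 p. 31] -/
theorem re_embedding_ne_zero_of_real {i : Fin 3} (hα : α i ≠ 0) (w : {w : InfinitePlace L // IsComplex w}) (hreal : (w.1.embedding (α i)).im = 0) :
    (w.1.embedding (α i)).re ≠ 0 := by
  intro hre
  have h0 : w.1.embedding (α i) = 0 := Complex.ext hre hreal
  exact hα ((map_eq_zero _).1 h0)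

/-- Relabelling by `swap x y` at `w` moves the `1`-slot: `((swap x y · ρ_w)⁻¹ 1 = ρ_w⁻¹ (swap x y 1)`. [cite: Shelstad1979, Lemma 4.2 (p. 23)] -/
theorem symm_swap_mul_apply_one (ρw : Perm (Fin 3)) (x y : Fin 3) :
    (Equiv.swap x y * ρw).symm 1 = ρw.symm (Equiv.swap x y 1) := by
  rw [Equiv.symm_apply_eq, Equiv.Perm.mul_apply, Equiv.apply_symm_apply, Equiv.swap_apply_self]

omit [IsCMField L] in
/-- **The κ-constant of the mirror partner**: `K_{ρ°} · sgn(slot ρ_w⁻¹ 1) = K_ρ · sgn(slot ρ_w⁻¹(swap x y 1))` for `ρ° = update ρ w (swap x y · ρ_w)` — only the `w`-factor of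
★ `archExplicitDelta_atlas_eq_mul`'s constant moves (the κ-TABLE: opposite form signs of the two exchanged slots ⇒ `K` flips; equal signs ⇒ `K` stays).
[cite: Rogawski1990, §4.9 p. 55; §14.6 p. 242] [cite: LanglandsShelstad1987, §2.4] -/
theorem kappaConst_update_swap_mul (ρ : {w : InfinitePlace L // IsComplex w} → Perm (Fin 3)) (w : {w : InfinitePlace L // IsComplex w}) (x y : Fin 3) :
    (∏ w' : {w : InfinitePlace L // IsComplex w},
        ((SignType.sign ((w'.1.embedding (α (lineOf (formSign L α w') ((Function.update ρ w (Equiv.swap x y * ρ w) w').symm 1)))).re) : ℤ) *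
          archMajoritySign L (Matrix.diagonal α) w')) *
        (SignType.sign ((w.1.embedding (α (lineOf (formSign L α w) ((ρ w).symm 1)))).re) : ℤ) =
      (∏ w' : {w : InfinitePlace L // IsComplex w},
        ((SignType.sign ((w'.1.embedding (α (lineOf (formSign L α w') ((ρ w').symm 1)))).re) : ℤ) * archMajoritySign L (Matrix.diagonal α) w')) *
        (SignType.sign ((w.1.embedding (α (lineOf (formSign L α w) ((ρ w).symm (Equiv.swap x y 1))))).re) : ℤ) := by
  rw [← Finset.mul_prod_erase Finset.univ _ (Finset.mem_univ w),
    ← Finset.mul_prod_erase Finset.univ (fun w' : {w : InfinitePlace L // IsComplex w} =>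
      (SignType.sign ((w'.1.embedding (α (lineOf (formSign L α w') ((ρ w').symm 1)))).re) : ℤ) * archMajoritySign L (Matrix.diagonal α) w') (Finset.mem_univ w),
    Function.update_self, symm_swap_mul_apply_one]
  rw [Finset.prod_congr rfl fun w' hw' => by rw [Function.update_of_ne (Finset.ne_of_mem_erase hw')]]
  ring

omit [IsCMField L] in
/-- **THE MIRROR-PAIRED FORM OF THE TWISTED PARTNER SUM.**  At a compact place `w ∉ S` of the chart and for two slots `x ≠ y` (real hermitian frame: `α_i ≠ 0`, `σ_w(α_i) ∈ ℝ`):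
`Σ_ρ (K_ρ·σ(ρ))·g(ρ·c) = ½ Σ_ρ (K_ρ·σ(ρ))·(g(ρ·c) − ε_ρ · g(s_ρ(ρ·c)))`, where `s_ρ` swaps the slots `ρ_w⁻¹x, ρ_w⁻¹y` at `w` and
`ε_ρ = sgn(slot ρ_w⁻¹(swap x y 1))·sgn(slot ρ_w⁻¹ 1) ∈ {±1}` (slot signs = `sgn re σ_w(α_{line of the slot})` = ★ `slotSign`): for the pair of slots carrying the
`U(Φ₁)`-angle and a 2-block angle (`{x, y} ∋ 1`) of OPPOSITE sign the bracket is `g + g∘s`, of EQUAL sign `g − g∘s` — the two mechanisms of (GLUE-X).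
[cite: Rogawski1990, §4.3 (4.3.1) p. 43; §4.9 p. 55] [cite: Shelstad1979, §4 p. 23; Prop. 4.5 (p. 26)] -/
theorem sum_kappaSign_slotPerm_eq_half_sum_pairs (hα : ∀ i, α i ≠ 0) {w : {w : InfinitePlace L // IsComplex w}} (hreal : ∀ i, (w.1.embedding (α i)).im = 0)
    {S : Finset {w : InfinitePlace L // IsComplex w}} (hw : w ∉ S) {x y : Fin 3} (hxy : x ≠ y)
    (g : ({w : InfinitePlace L // IsComplex w} → Fin 3 → ℝ) → ℂ) (c : {w : InfinitePlace L // IsComplex w} → Fin 3 → ℝ) :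
    ∑ ρ ∈ partnerPerms S,
        (((∏ w' : {w : InfinitePlace L // IsComplex w},
            ((SignType.sign ((w'.1.embedding (α (lineOf (formSign L α w') ((ρ w').symm 1)))).re) : ℤ) * archMajoritySign L (Matrix.diagonal α) w') : ℤ) : ℂ) *
          ∏ w' : {w : InfinitePlace L // IsComplex w}, (Equiv.Perm.sign (ρ w') : ℂ)) * g (slotPerm ρ c) =
      (1 / 2 : ℂ) * ∑ ρ ∈ partnerPerms S,
        (((∏ w' : {w : InfinitePlace L // IsComplex w},
            ((SignType.sign ((w'.1.embedding (α (lineOf (formSign L α w') ((ρ w').symm 1)))).re) : ℤ) * archMajoritySign L (Matrix.diagonal α) w') : ℤ) : ℂ) *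
          ∏ w' : {w : InfinitePlace L // IsComplex w}, (Equiv.Perm.sign (ρ w') : ℂ)) *
        (g (slotPerm ρ c) -
          (((SignType.sign ((w.1.embedding (α (lineOf (formSign L α w) ((ρ w).symm (Equiv.swap x y 1))))).re) : ℤ) *
              (SignType.sign ((w.1.embedding (α (lineOf (formSign L α w) ((ρ w).symm 1)))).re) : ℤ) : ℤ) : ℂ) *
            g (Function.update (slotPerm ρ c) w ((slotPerm ρ c) w ∘ ⇑(Equiv.swap ((ρ w).symm x) ((ρ w).symm y))))) := by
  rw [sum_partnerPerms_eq_half_sum_add_update hw (Equiv.swap x y)]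
  congr 1
  refine Finset.sum_congr rfl fun ρ _ => ?_
  rw [slotPerm_update_swap_mul, prod_sign_update_swap_mul ρ w hxy]
  -- the κ-constants of the pair
  have hK := kappaConst_update_swap_mul L α ρ w x y
  have hs1 := sign_intCast_mul_self' (re_embedding_ne_zero_of_real L α (hα (lineOf (formSign L α w) ((ρ w).symm 1))) w (hreal _))
  set K' : ℤ := ∏ w' : {w : InfinitePlace L // IsComplex w},
      ((SignType.sign ((w'.1.embedding (α (lineOf (formSign L α w') ((Function.update ρ w (Equiv.swap x y * ρ w) w').symm 1)))).re) : ℤ) *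
        archMajoritySign L (Matrix.diagonal α) w') with hK'
  set K : ℤ := ∏ w' : {w : InfinitePlace L // IsComplex w},
      ((SignType.sign ((w'.1.embedding (α (lineOf (formSign L α w') ((ρ w').symm 1)))).re) : ℤ) * archMajoritySign L (Matrix.diagonal α) w') with hKdef
  set s1 : ℤ := (SignType.sign ((w.1.embedding (α (lineOf (formSign L α w) ((ρ w).symm 1)))).re) : ℤ) with hs1def
  set sxy : ℤ := (SignType.sign ((w.1.embedding (α (lineOf (formSign L α w) ((ρ w).symm (Equiv.swap x y 1))))).re) : ℤ) with hsxydef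
  -- `K' = K · sxy · s1` (from `K'·s1 = K·sxy` and `s1² = 1`)
  have hK'eq : (K' : ℂ) = (K : ℂ) * (sxy : ℂ) * (s1 : ℂ) := by
    have h : (K' : ℤ) = K * sxy * s1 := by
      calc (K' : ℤ) = K' * (s1 * s1) := by rw [hs1, mul_one]
        _ = (K' * s1) * s1 := by ring
        _ = (K * sxy) * s1 := by rw [hK]
        _ = K * sxy * s1 := by ring
    exact_mod_cast h
  rw [hK'eq]
  push_cast
  ring

end Pairing

end Literature.NumberTheory.Rogawski1990

end
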